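import Literature.NumberTheory.CubicFields.IndexPOverring
import HarnessLib

/-!
# Subrings of index `p` of a cubic ring: the lattice of a line, and the congruence `g(s, t) ≡ 0 (mod p)` (towards BTT Lemma 2.3 (ii))

Topic `Literature/NumberTheory/CubicFields`; built on `DavenportHeilbronnMaximalityConverse.lean`
(`detOnQuot`, `exists_eq_detOnQuot_mul`, `exists_mul_add_mul_prime_eq_one`) and
`IndexPOverring.lean` (`natAbs_detOnQuot_ringEquiv`).

Bhargava–Taniguchi–Thorne 2023, Lemma 2.3 (ii): "For any ring `R'`, the number of `R` contained in
`R'` with index `q` is bounded above by `∏_{p ∣ q, p ∤ ct(R')} 3 · ∏_{p ∣ q, p ∣ ct(R')} (p + 1)`."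
For `q = p` prime this rests on the following description of the index-`p` subrings of
`R' = R(g) = ℤ + ℤω + ℤθ`, proved here for the image `H = φ(R(f))` of any injective
`φ : R(f) ↪ R(g)` with `|detOnQuot φ| = p`:

* `RingOfForm.natCast_mul_mem_range` — `p R(g) ⊆ H`;
* `RingOfForm.exists_mem_range_not_dvd` — `H ⊄ ℤ + pR(g)`: some `w ∈ H` has `(w.y, w.z) ≢ 0 (mod p)`;
* `RingOfForm.lineLattice`, **`range_eq_lineLattice`** — `H = {P : (P.y, P.z) ≡ λ (w.y, w.z) (mod p)}`
  is the lattice `ℤ + ℤw + pR(g)` of the line `ℓ = [w.y : w.z] ∈ ℙ¹(𝔽_p)`;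
* **`RingOfForm.dvd_eval_of_range`** — since `H` is a ring (`w² ∈ H`), **`p ∣ g(w.y, w.z)`**: the
  line `ℓ` is a zero of `g (mod p)` (the identity `(w²).y · t − (w²).z · s = g(s, t)` for
  `w = x + sω + tθ`, `sq_y_mul_sub_sq_z_mul`).

So the index-`p` subrings of `R(g)` correspond injectively to zeros of `g` in `ℙ¹(𝔽_p)` — at most
`3` unless `g ≡ 0 (mod p)`, and `p + 1` lines in all (the count is `IndexPSubringCount.lean`).

## References

* M. Bhargava, T. Taniguchi, F. Thorne, *Improved error estimates for the Davenport–Heilbronn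
  theorems*, Math. Ann. 389 (2024) = arXiv:2107.12819, Lemma 2.3 (ii) [BhargavaTaniguchiThorne2023].
-/

namespace Literature.NumberTheory.CubicFields

namespace RingOfForm

open BinaryCubic

variable {f g : BinaryCubic ℤ}

/-! ### The key identity: `(w²).y t − (w²).z s = g(s, t)` -/

/-- For `w = x + sω + tθ ∈ R(g)`: `(w²).y · t − (w²).z · s = g(s, t)`. [folklore] -/
theorem sq_y_mul_sub_sq_z_mul (w : RingOfForm g) : (w * w).y * w.z - (w * w).z * w.y = g.eval w.y w.z := by
  simp only [mul_y, mul_z, BinaryCubic.eval]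
  ring

/-! ### `p R(g) ⊆ H ⊄ ℤ + p R(g)` for an image `H` of index `p` -/

section Index

variable (φ : RingOfForm f →+* RingOfForm g) {p : ℕ}

/-- **`p · R(g) ⊆ φ(R f)`** when `|detOnQuot φ| = p`. [folklore] -/
theorem natCast_mul_mem_range (h : (detOnQuot φ).natAbs = p) (y : RingOfForm g) :
    (p : RingOfForm g) * y ∈ Set.range φ := by
  obtain ⟨r, hr⟩ := exists_eq_detOnQuot_mul φ y
  rcases Int.natAbs_eq (detOnQuot φ) with hd | hd <;> rw [h] at hd
  · exact ⟨r, by rw [hr, hd, Int.cast_natCast]⟩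
  · exact ⟨-r, by rw [map_neg, hr, hd, Int.cast_neg, Int.cast_natCast]; ring⟩

/-- An element with `p ∣ y, z`-coordinates lies in `ℤ + pR(g) ⊆ φ(R f)`. [folklore] -/
theorem mem_range_of_dvd (h : (detOnQuot φ).natAbs = p) {P : RingOfForm g} (hy : (p : ℤ) ∣ P.y) (hz : (p : ℤ) ∣ P.z) :
    P ∈ Set.range φ := by
  obtain ⟨y', hy'⟩ := hy
  obtain ⟨z', hz'⟩ := hz
  have hP : P = (P.x : RingOfForm g) + (p : RingOfForm g) * ⟨0, y', z'⟩ := by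
    ext <;> simp [hy', hz']
  obtain ⟨r, hr⟩ := natCast_mul_mem_range φ h ⟨0, y', z'⟩
  exact ⟨(P.x : RingOfForm f) + r, by rw [map_add, map_intCast, hr, ← hP]⟩

/-- An index-`p` image is a proper subring (`p > 1`). [folklore] -/
theorem not_surjective_of_natAbs_detOnQuot (hp : 1 < p) (hφ : Function.Injective φ) (h : (detOnQuot φ).natAbs = p) :
    ¬ Function.Surjective φ := by
  intro hs
  have h1 := natAbs_detOnQuot_ringEquiv (RingEquiv.ofBijective φ ⟨hφ, hs⟩)
  change (detOnQuot φ).natAbs = 1 at h1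
  omega

/-- **`H ⊄ ℤ + pR(g)`**: one of `φ(ω), φ(θ)` has `(y, z) ≢ 0 (mod p)` — otherwise `p² ∣ detOnQuot φ = ±p`. [folklore] -/
theorem exists_mem_range_not_dvd (hp : 1 < p) (h : (detOnQuot φ).natAbs = p) :
    ∃ w ∈ Set.range φ, ¬ ((p : ℤ) ∣ w.y ∧ (p : ℤ) ∣ w.z) := by
  by_contra hall
  push Not at hall
  obtain ⟨h1, h2⟩ := hall (φ (omega f)) ⟨_, rfl⟩
  obtain ⟨h3, h4⟩ := hall (φ (theta f)) ⟨_, rfl⟩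
  have hdvd : ((p : ℤ) * p) ∣ detOnQuot φ := by
    rw [detOnQuot]
    exact dvd_sub (mul_dvd_mul h1 h4) (mul_dvd_mul h3 h2)
  have hnat : p * p ∣ p := by
    have := Int.natAbs_dvd_natAbs.mpr hdvd
    rwa [Int.natAbs_mul, Int.natAbs_natCast, h] at this
  have hp0 : 0 < p := by omega
  have : p * p ≤ p := Nat.le_of_dvd hp0 hnat
  nlinarith

end Index

/-! ### The lattice of a line -/

/-- **The lattice of the line `[s : t] ∈ ℙ¹(𝔽_p)`**: the elements of `R(g)` whose
`(ω, θ)`-coordinates are proportional to `(s, t)` modulo `p`, i.e. `ℤ + ℤ(sω + tθ) + pR(g)`. [folklore] -/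
def lineLattice (g : BinaryCubic ℤ) (p : ℕ) (s t : ℤ) : Set (RingOfForm g) :=
  {P | (p : ℤ) ∣ P.y * t - P.z * s}

/-- Membership in the lattice of a line. [folklore] -/
theorem mem_lineLattice {p : ℕ} {s t : ℤ} {P : RingOfForm g} :
    P ∈ lineLattice g p s t ↔ (p : ℤ) ∣ P.y * t - P.z * s := Iff.rfl

/-- Collinear with a vector that is nonzero mod `p` means proportional mod `p`. [folklore] -/
theorem exists_dvd_sub_mul_of_dvd {p : ℕ} (hp : p.Prime) {s t y z : ℤ} (hst : ¬ ((p : ℤ) ∣ s ∧ (p : ℤ) ∣ t))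
    (h : (p : ℤ) ∣ y * t - z * s) : ∃ lam : ℤ, (p : ℤ) ∣ y - lam * s ∧ (p : ℤ) ∣ z - lam * t := by
  by_cases hs : (p : ℤ) ∣ s
  · have ht : ¬ (p : ℤ) ∣ t := fun ht => hst ⟨hs, ht⟩
    obtain ⟨e, k, hek⟩ := exists_mul_add_mul_prime_eq_one hp ht
    refine ⟨z * e, ?_, ?_⟩
    · -- `y - z e s = y k p + e (y t - z s)`
      have : y - z * e * s = (p : ℤ) * (y * k) + e * (y * t - z * s) := by linear_combination (-y) * hek
      rw [this]
      exact dvd_add (dvd_mul_right _ _) (dvd_mul_of_dvd_right h e)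
    · have : z - z * e * t = (p : ℤ) * (z * k) := by linear_combination (-z) * hek
      rw [this]
      exact dvd_mul_right _ _
  · obtain ⟨e, k, hek⟩ := exists_mul_add_mul_prime_eq_one hp hs
    refine ⟨y * e, ?_, ?_⟩
    · have : y - y * e * s = (p : ℤ) * (y * k) := by linear_combination (-y) * hek
      rw [this]
      exact dvd_mul_right _ _
    · have : z - y * e * t = (p : ℤ) * (z * k) - e * (y * t - z * s) := by linear_combination (-z) * hek
      rw [this]
      exact dvd_sub (dvd_mul_right _ _) (dvd_mul_of_dvd_right h e)

section Classify

variable (φ : RingOfForm f →+* RingOfForm g) {p : ℕ}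

/-- **`φ(R f)` is the lattice of the line through `(w.y, w.z)`** for any `w ∈ φ(R f)` with
`(w.y, w.z) ≢ 0 (mod p)`, when `φ` is injective of index `p` (prime): `H ⊆ lattice` because an
element off the line would, by Cramer's rule mod `p`, generate all of `R(g)` together with `w`, `1`
and `pR(g) ⊆ H`; `lattice ⊆ H` because `P ≡ λw + c (mod pR(g))`. [folklore] -/
theorem range_eq_lineLattice (hp : p.Prime) (hφ : Function.Injective φ) (h : (detOnQuot φ).natAbs = p)
    {w : RingOfForm g} (hw : w ∈ Set.range φ) (hnd : ¬ ((p : ℤ) ∣ w.y ∧ (p : ℤ) ∣ w.z)) :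
    Set.range φ = lineLattice g p w.y w.z := by
  have hsub : ∀ P ∈ Set.range φ, P ∈ lineLattice g p w.y w.z := by
    intro P hP
    rw [mem_lineLattice]
    by_contra hD
    apply not_surjective_of_natAbs_detOnQuot φ hp.one_lt hφ h
    -- Cramer mod `p`: every `Q` is `≡ αP + βw + γ (mod pR(g))`
    obtain ⟨u, k, huk⟩ := exists_mul_add_mul_prime_eq_one hp hD
    intro Q
    set α : ℤ := u * (Q.y * w.z - Q.z * w.y) with hα
    set β : ℤ := u * (P.y * Q.z - P.z * Q.y) with hβ
    have hy : (p : ℤ) ∣ (Q - (α : RingOfForm g) * P - (β : RingOfForm g) * w).y := by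
      refine ⟨Q.y * k, ?_⟩
      simp only [sub_y, intCast_mul_y]
      linear_combination (-Q.y) * huk
    have hz : (p : ℤ) ∣ (Q - (α : RingOfForm g) * P - (β : RingOfForm g) * w).z := by
      refine ⟨Q.z * k, ?_⟩
      simp only [sub_z, intCast_mul_z]
      linear_combination (-Q.z) * huk
    obtain ⟨r, hr⟩ := mem_range_of_dvd φ h hy hz
    obtain ⟨rP, rfl⟩ := hP
    obtain ⟨rw, rfl⟩ := hw
    refine ⟨r + (α : RingOfForm f) * rP + (β : RingOfForm f) * rw, ?_⟩
    rw [map_add, map_add, map_mul, map_mul, map_intCast, map_intCast, hr]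
    abel
  ext P
  refine ⟨hsub P, fun hP => ?_⟩
  obtain ⟨lam, hy, hz⟩ := exists_dvd_sub_mul_of_dvd hp hnd hP
  have hy' : (p : ℤ) ∣ (P - (lam : RingOfForm g) * w).y := by simpa [sub_y, intCast_mul_y] using hy
  have hz' : (p : ℤ) ∣ (P - (lam : RingOfForm g) * w).z := by simpa [sub_z, intCast_mul_z] using hz
  obtain ⟨r, hr⟩ := mem_range_of_dvd φ h hy' hz'
  obtain ⟨rw, rfl⟩ := hw
  exact ⟨r + (lam : RingOfForm f) * rw, by rw [map_add, map_mul, map_intCast, hr]; abel⟩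

/-- **The line of an index-`p` subring is a zero of `g (mod p)`**: with `w ∈ H = φ(R f)`,
`(w.y, w.z) ≢ 0 (mod p)`, we have `p ∣ g(w.y, w.z)` — because `w² ∈ H = lineLattice(w)` and
`(w²).y w.z − (w²).z w.y = g(w.y, w.z)`. This is the source of the factor `3` (at most three zeros
of `g` in `ℙ¹(𝔽_p)` when `p ∤ ct(g)`) in BTT Lemma 2.3 (ii). [cite: BhargavaTaniguchiThorne2023, Lemma 2.3 (ii) (index-p subrings of R' ↔ zeros of its form mod p; at most 3 when p ∤ ct(R'))] -/
theorem dvd_eval_of_range (hp : p.Prime) (hφ : Function.Injective φ) (h : (detOnQuot φ).natAbs = p)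
    {w : RingOfForm g} (hw : w ∈ Set.range φ) (hnd : ¬ ((p : ℤ) ∣ w.y ∧ (p : ℤ) ∣ w.z)) :
    (p : ℤ) ∣ g.eval w.y w.z := by
  have hw2 : w * w ∈ Set.range φ := by
    obtain ⟨r, rfl⟩ := hw
    exact ⟨r * r, map_mul φ r r⟩
  rw [range_eq_lineLattice φ hp hφ h hw hnd, mem_lineLattice] at hw2
  rwa [sq_y_mul_sub_sq_z_mul] at hw2

/-- Two nondegenerate vectors of the same index-`p` image span the same line mod `p`. [folklore] -/
theorem dvd_det_of_mem_range (hp : p.Prime) (hφ : Function.Injective φ) (h : (detOnQuot φ).natAbs = p)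
    {w w' : RingOfForm g} (hw : w ∈ Set.range φ) (hnd : ¬ ((p : ℤ) ∣ w.y ∧ (p : ℤ) ∣ w.z))
    (hw' : w' ∈ Set.range φ) : (p : ℤ) ∣ w'.y * w.z - w'.z * w.y := by
  rw [range_eq_lineLattice φ hp hφ h hw hnd] at hw'
  exact hw'

end Classify

end RingOfForm

end Literature.NumberTheory.CubicFields
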